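import Literature.Combinatorics.Designs.SixTurynType

/-!
# Hadamard 668 census — the full 6-Turyn-type family at `v = 167`: every `(m, n)` with `2m + n = 167`

Framing: lottery ticket; floor = certified bounds/negative ranges.

Cell pub-namedobj (venture DiscreteObjects), target (H).  `TurynTypeFamily668.lean` typed the route `TT(56) ⇒ H(668)`;
but the Kharaghani–Tayfeh-Rezaie construction (Seberry–Yamada 2020 Definition 5.3 / Theorem 5.2) takes 6-Turyn-type
sequences `(A, B, C, C, D, D)` of lengths `m, m, m, m, n, n` for ANY `n`, giving a Hadamard matrix of order
`4(2m + n)`.  At `668 = 4·167` this is the whole line `2m + n = 167`, `1 ≤ m ≤ 83` (`TT(56)` is the point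
`(m, n) = (56, 55)`; `(83, 1)` is four `±1` sequences of length `83, 83, 83` and a single sign).  This file records,
from the kernel theorem `sixTurynType_isHadamard` (Literature/…/SixTurynType):
* `hadamard668_of_sixTurynType` — 6-Turyn-type `(m; n)` with `2m + n = 167` ⇒ an explicit Hadamard matrix of order
  `668` (Goethals–Seidel array on the Cooper–Wallis rows of the T-sequences of length `167`);
* `exists_hadamard668_of_sixTurynType` — the existence form over the whole parameter line;
* `sixTurynType167_sum_sq` — the grammar `x² + y² + 2z² + 2w² = 334` for every member;
* `sixTurynType167_params` — the parameter line: `2m + n = 167` forces `m ≤ 83` and `n` odd.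
Nothing here asserts that any member exists (none is known in print: the searched instances are `n = m - 1`, i.e.
`TT(m)`, `m ≤ 40`); no order excluded; H(668) untouched; HITS 0.  No `sorry`.
-/

open Finset BigOperators

namespace Summit.Ventures.DiscreteObjects.Hadamard

open Literature.Combinatorics.Designs.GoethalsSeidel (gsMatrix IsHadamardMatrix)
open Literature.Combinatorics.Designs.TSequences
open Literature.Combinatorics.Designs.BaseSequences
open Literature.Combinatorics.Designs.SixTurynType

/-- **6-Turyn-type `(m; n)` with `2m + n = 167` ⇒ H(668)** (SY 2020 Theorem 5.2 at `2m + n = 167`). -/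
theorem hadamard668_of_sixTurynType {m n : ℕ} {x y z w : ℕ → ℤ} (h : IsSixTurynType m n x y z w)
    (hmn : m + n + m = 167) :
    IsHadamardMatrix (gsMatrix (cwSeq 167 (sixT m n x y z w) 0) (cwSeq 167 (sixT m n x y z w) 1)
      (cwSeq 167 (sixT m n x y z w) 2) (cwSeq 167 (sixT m n x y z w) 3)) :=
  sixTurynType_isHadamard h 167 hmn.symm

/-- existence form over the whole parameter line: **if 6-Turyn-type sequences of lengths `m, m, m, m, n, n` with
`2m + n = 167` exist for some `(m, n)`, a Hadamard matrix of order `668` exists.** -/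
theorem exists_hadamard668_of_sixTurynType
    (h : ∃ (m n : ℕ) (x y z w : ℕ → ℤ), IsSixTurynType m n x y z w ∧ m + n + m = 167) :
    ∃ H : Matrix (Fin 4 × ZMod 167) (Fin 4 × ZMod 167) ℤ, IsHadamardMatrix H ∧ Fintype.card (Fin 4 × ZMod 167) = 668 := by
  obtain ⟨m, n, x, y, z, w, h, hmn⟩ := h
  exact ⟨_, hadamard668_of_sixTurynType h hmn, by simp [ZMod.card]⟩

/-- `TT(56)` is the member `(56, 55)` of the line (consistency with `TurynTypeFamily668.hadamard668_of_turynType56`). -/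
theorem turynType56_sixTurynType {x y z w : ℕ → ℤ} (h : IsTurynType 56 x y z w) : IsSixTurynType 56 55 x y z w :=
  turynType_sixTurynType h

/-- **grammar on the line**: every member `(m; n)`, `2m + n = 167`, has element sums with `x² + y² + 2z² + 2w² = 334`. -/
theorem sixTurynType167_sum_sq {m n : ℕ} {x y z w : ℕ → ℤ} (h : IsSixTurynType m n x y z w) (hmn : m + n + m = 167) :
    (∑ i ∈ range m, x i) ^ 2 + (∑ i ∈ range m, y i) ^ 2 + 2 * (∑ i ∈ range m, z i) ^ 2 +
      2 * (∑ i ∈ range n, w i) ^ 2 = 334 := by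
  have e := sixTurynType_sum_sq h
  have hc : (2 * (m : ℤ) + n) = 167 := by exact_mod_cast (by omega : 2 * m + n = 167)
  rw [hc] at e
  norm_num at e
  exact e

/-- the parameter line: `2m + n = 167` forces `m ≤ 83`, `n = 167 - 2m` odd (so `n ≥ 1`); there are `84` pairs
`(m, n)` with `m ≥ 0`, `83` with `m ≥ 1`. -/
theorem sixTurynType167_params (m n : ℕ) (hmn : m + n + m = 167) : m ≤ 83 ∧ n = 167 - 2 * m ∧ n % 2 = 1 := by
  omega

end Summit.Ventures.DiscreteObjects.Hadamard
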